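import Summits.Schanuel.Schanuel.Theorems.ZilberEacDoubleCancellingSolutions
import Summits.Schanuel.Schanuel.Theorems.ZilberEacTwoScaleElimination
import Summits.Schanuel.Schanuel.Theorems.ZilberEacRealHyperplaneDensity
import HarnessLib

/-!
# The double-cancelling regime: Zariski density of the exponential points

Zilber's Exponential-Algebraic Closedness, case ladder (host summit Schanuel, cell `pub-schanuel`,
seat 2, gen 15; HANDOFF O59).  For the explicit free, rotund, not linearly split family
`W = {x₂ = r₀x₀ + r₁x₁ + c, y₀ = x₀ + y₂F₀(y₂), y₁ = x₁ + y₂F₁(y₂)} ⊆ ℂ³ × ℂ³`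
with `F₀F₁ ≠ 0`, `deg F₁ < deg F₀`, MIXED SIGNS `r₀r₁ < 0` and `r₁/r₀ ∉ ℚ`, the exponential points
are Zariski dense: `I(W ∩ Γ_exp) = I(W)`.  This covers the RESONANT mixed-sign planes
`e₀r₀ + e₁r₁ = 1`, `e₀ ≠ e₁` left open by `unprojectedDense_polyFibredGraph_hyperplane_offResonance`.

Method (the DOUBLE-CANCELLING regime, new): both fibre coordinates sit at the cancelling fixed
point `xⱼ = −Wⱼ + ψ(e^{−Wⱼ})` (`exists_solutions_doubleCancelling`); the phase of the free label is
chosen by `exists_doubleCancelling_phase` (a sign `s = ±1` and a branch `j₀` of the `e₀`-th root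
making the top coefficient of `Re W₁` positive — a roots-of-unity averaging argument); density is
THEOREM I″ (`unprojectedDense_of_twoScale`) on the coordinates `(y₀, y₁, y₂)` with the two scales
`log|y₀| ≈ (r₁/r₀)T`, `log|y₁| = −T` (`T = −Re x₁ → ∞`) and the slow coordinate `log|y₂| = o(T)`.

* `arg_neg_eq_arg_add_pi_or_sub_pi`, `exists_re_pos_of_rotations`, `exists_doubleCancelling_phase`,
  `doubleCancellingWeights_injective` — the phase and weight lemmas.
* **`unprojectedDense_polyFibredGraph_doubleCancelling`** — the density theorem.

HONEST FRAMING: explicit families inside the OPEN cell `ECCell 3 2`; NOT Schanuel's conjecture;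
EAC ⇏ SC.
-/

noncomputable section

open Complex MvPolynomial Filter Topology
open Literature.NumberTheory.Transcendental Literature.ModelTheory.Zilber

set_option linter.dupNamespace false

namespace Summit.Schanuel.Schanuel.Theorems

section Phase

/-- `arg(−x) = arg x ± π` for `x ≠ 0`. [folklore] -/
theorem arg_neg_eq_arg_add_pi_or_sub_pi {x : ℂ} (hx : x ≠ 0) :
    Complex.arg (-x) = Complex.arg x + Real.pi ∨ Complex.arg (-x) = Complex.arg x - Real.pi := by
  rcases lt_trichotomy x.im 0 with hi | hi | hi
  · exact Or.inl (Complex.arg_neg_eq_arg_add_pi_of_im_neg hi)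
  · rcases lt_trichotomy x.re 0 with hr | hr | hr
    · exact Or.inr (Complex.arg_neg_eq_arg_sub_pi_iff.2 (Or.inr ⟨hi, hr⟩))
    · exact absurd (Complex.ext (by simpa using hr) (by simpa using hi)) hx
    · exact Or.inl (Complex.arg_neg_eq_arg_add_pi_iff.2 (Or.inr ⟨hi, hr⟩))
  · exact Or.inr (Complex.arg_neg_eq_arg_sub_pi_of_im_pos hi)

/-- **Rotations cannot all avoid the right half-plane.**  If `u ≠ 0`, `ζ ≠ 1`, `ζ^N = 1` (`N ≥ 1`)
and `Im ξ ≠ 0`, then some `uζʲ` or some `uξζʲ` has positive real part: otherwise averaging over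
`j < N` (`Σ ζʲ = 0`) forces `Re u = Re(uξ) = 0`, i.e. `u ∈ iℝ` and `ξ ∈ ℝ`. [folklore] -/
theorem exists_re_pos_of_rotations {u ζ ξ : ℂ} {N : ℕ} (hN : 0 < N) (hu : u ≠ 0) (hζ1 : ζ ≠ 1)
    (hζN : ζ ^ N = 1) (hξ : ξ.im ≠ 0) :
    ∃ j : ℕ, 0 < (u * ζ ^ j).re ∨ 0 < (u * ξ * ζ ^ j).re := by
  by_contra h
  have h' : ∀ j : ℕ, (u * ζ ^ j).re ≤ 0 ∧ (u * ξ * ζ ^ j).re ≤ 0 := fun j =>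
    ⟨not_lt.1 fun hj => h ⟨j, Or.inl hj⟩, not_lt.1 fun hj => h ⟨j, Or.inr hj⟩⟩
  have hsum : ∑ j ∈ Finset.range N, ζ ^ j = 0 := by
    rw [geom_sum_eq hζ1, hζN, sub_self, zero_div]
  have key : ∀ w : ℂ, (∀ j : ℕ, (w * ζ ^ j).re ≤ 0) → w.re = 0 := by
    intro w hw
    have hs : ∑ j ∈ Finset.range N, (w * ζ ^ j).re = 0 := by
      rw [← Complex.re_sum, ← Finset.mul_sum, hsum, mul_zero, Complex.zero_re]
    have hall := (Finset.sum_eq_zero_iff_of_nonpos fun j _ => hw j).1 hs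
    simpa using hall 0 (Finset.mem_range.2 hN)
  have h1 : u.re = 0 := key u fun j => (h' j).1
  have h2 : (u * ξ).re = 0 := key (u * ξ) fun j => (h' j).2
  rw [Complex.mul_re, h1, zero_mul, zero_sub, neg_eq_zero, mul_eq_zero] at h2
  rcases h2 with h2 | h2
  · exact hu (Complex.ext (by simpa using h1) (by simpa using h2))
  · exact hξ h2

/-- **Phase choice for the double-cancelling regime.**  For `a₀a₁ ≠ 0`, `r₀ ≠ 0` and `1 ≤ e₁ < e₀`
there are a sign `s = ±1`, a branch `j₀` and `κ > 0` with
`κ|a₁| ≤ Re(a₁ · exp(e₁(i·arg(2πi/(r₀a₀s)) + 2πij₀)/e₀))`: the available phases are `u·ξᵏ`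
(`ξ = e^{iπe₁/e₀}`, `0 < πe₁/e₀ < π`, even `k` from `s = 1`, odd `k` from `s = −1` since
`arg(−q) = arg q ± π`), and `exists_re_pos_of_rotations` applies with `ζ = ξ²`. (new) -/
theorem exists_doubleCancelling_phase {e₀ e₁ : ℕ} (he₁ : 1 ≤ e₁) (he : e₁ < e₀) {a₁ : ℂ}
    (ha₁ : a₁ ≠ 0) {r₀ : ℝ} (hr₀ : r₀ ≠ 0) {a₀ : ℂ} (ha₀ : a₀ ≠ 0) :
    ∃ s : ℝ, (s = 1 ∨ s = -1) ∧ ∃ (j₀ : ℕ) (κ : ℝ), 0 < κ ∧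
      κ * ‖a₁‖ ≤ (a₁ * exp ((e₁ : ℂ) *
        (((Complex.arg (2 * Real.pi * I / ((r₀ : ℂ) * (a₀ * s))) : ℝ) : ℂ) * I +
          2 * Real.pi * I * (j₀ : ℂ)) / (e₀ : ℂ))).re := by
  have heC : (e₀ : ℂ) ≠ 0 := by exact_mod_cast (show e₀ ≠ 0 by omega)
  have heR : (0 : ℝ) < e₀ := by exact_mod_cast (show 0 < e₀ by omega)
  have ha₁n : ‖a₁‖ ≠ 0 := norm_ne_zero_iff.2 ha₁
  set q : ℂ := 2 * Real.pi * I / ((r₀ : ℂ) * a₀) with hq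
  have hq0 : q ≠ 0 :=
    div_ne_zero Complex.two_pi_I_ne_zero (mul_ne_zero (by exact_mod_cast hr₀) ha₀)
  set α : ℝ := Real.pi * e₁ / e₀ with hα
  have hαpos : 0 < α := by positivity
  have hαlt : α < Real.pi := by
    have h1 : (e₁ : ℝ) < e₀ := by exact_mod_cast he
    rw [hα, div_lt_iff₀ heR]
    nlinarith [Real.pi_pos]
  have hsin : 0 < Real.sin α := Real.sin_pos_of_pos_of_lt_pi hαpos hαlt
  set ξ : ℂ := exp ((α : ℂ) * I) with hξ
  have hξim : ξ.im = Real.sin α := by rw [hξ, Complex.exp_ofReal_mul_I_im]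
  have hξ1 : ξ ^ 2 ≠ 1 := by
    intro h
    rcases sq_eq_one_iff.1 h with h' | h'
    · have := congrArg Complex.im h'
      rw [hξim, Complex.one_im] at this
      linarith
    · have := congrArg Complex.im h'
      rw [hξim, Complex.neg_im, Complex.one_im, neg_zero] at this
      linarith
  have hξN : (ξ ^ 2) ^ e₀ = 1 := by
    rw [← pow_mul, hξ, ← Complex.exp_nat_mul]
    have : ((2 * e₀ : ℕ) : ℂ) * ((α : ℂ) * I) = (e₁ : ℕ) * (2 * Real.pi * I) := by
      rw [hα]; push_cast; field_simp
    rw [this]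
    exact Complex.exp_nat_mul_two_pi_mul_I e₁
  set u : ℂ := a₁ * exp ((((e₁ : ℝ) * Complex.arg q / e₀ : ℝ) : ℂ) * I) with hu
  have hu0 : u ≠ 0 := mul_ne_zero ha₁ (Complex.exp_ne_zero _)
  -- the phase points as rotations of `u`
  have hval : ∀ (φ : ℝ) (j : ℕ), a₁ * exp ((e₁ : ℂ) * (((φ : ℝ) : ℂ) * I +
      2 * Real.pi * I * (j : ℂ)) / (e₀ : ℂ)) =
      u * exp ((((e₁ : ℝ) * (φ - Complex.arg q) / e₀ : ℝ) : ℂ) * I) * (ξ ^ 2) ^ j := by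
    intro φ j
    rw [hu, hξ, ← pow_mul, ← Complex.exp_nat_mul, mul_assoc a₁, mul_assoc a₁, ← Complex.exp_add,
      ← Complex.exp_add]
    congr 2
    rw [hα]
    push_cast
    field_simp
    ring
  have hs1 : (2 * Real.pi * I / ((r₀ : ℂ) * (a₀ * ((1 : ℝ) : ℂ)))) = q := by
    rw [Complex.ofReal_one, mul_one]
  have hs2 : (2 * Real.pi * I / ((r₀ : ℂ) * (a₀ * ((-1 : ℝ) : ℂ)))) = -q := by
    rw [Complex.ofReal_neg, Complex.ofReal_one, mul_neg, mul_one, mul_neg, div_neg]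
  -- the odd rotation `ξ'` coming from `s = -1`
  have hξ' : (exp ((((e₁ : ℝ) * (Complex.arg (-q) - Complex.arg q) / e₀ : ℝ) : ℂ) * I)).im ≠ 0 := by
    rw [Complex.exp_ofReal_mul_I_im]
    rcases arg_neg_eq_arg_add_pi_or_sub_pi hq0 with h | h
    · rw [h, show (e₁ : ℝ) * (Complex.arg q + Real.pi - Complex.arg q) / e₀ = α by rw [hα]; ring]
      exact hsin.ne'
    · rw [h, show (e₁ : ℝ) * (Complex.arg q - Real.pi - Complex.arg q) / e₀ = -α by rw [hα]; ring,
        Real.sin_neg]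
      exact neg_ne_zero.2 hsin.ne'
  obtain ⟨j, hj⟩ := exists_re_pos_of_rotations (by omega : 0 < e₀) hu0 hξ1 hξN hξ'
  rcases hj with hj | hj
  · refine ⟨1, Or.inl rfl, j, (u * (ξ ^ 2) ^ j).re / ‖a₁‖, div_pos hj (norm_pos_iff.2 ha₁), ?_⟩
    rw [hs1, hval, sub_self, mul_zero, zero_div, Complex.ofReal_zero, zero_mul, Complex.exp_zero,
      mul_one, div_mul_cancel₀ _ ha₁n]
  · refine ⟨-1, Or.inr rfl, j, (u * exp ((((e₁ : ℝ) * (Complex.arg (-q) - Complex.arg q) / e₀ : ℝ) :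
      ℂ) * I) * (ξ ^ 2) ^ j).re / ‖a₁‖, div_pos hj (norm_pos_iff.2 ha₁), ?_⟩
    rw [hs2, hval, div_mul_cancel₀ _ ha₁n]

/-- **The two-scale weights of the double-cancelling regime are independent**: with `γ₀ = r₁/r₀ ∉ ℚ`
and `γ₁ = −1`, `aγ₀ + bγ₁ = a′γ₀ + b′γ₁` for naturals forces `a = a′`, `b = b′`. [folklore] -/
theorem doubleCancellingWeights_injective {γ : ℝ} (hγ : Irrational γ) (a b a' b' : ℕ)
    (h : (a : ℝ) * γ + (b : ℝ) * (-1) = (a' : ℝ) * γ + (b' : ℝ) * (-1)) : a = a' ∧ b = b' := by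
  by_cases haa : a = a'
  · subst haa
    refine ⟨rfl, ?_⟩
    have : (b : ℝ) = b' := by linarith
    exact_mod_cast this
  · exfalso
    have hne : (a : ℝ) - a' ≠ 0 := sub_ne_zero.2 (by exact_mod_cast haa)
    have hγeq : γ = ((b : ℝ) - b') / ((a : ℝ) - a') := by
      field_simp
      linarith
    exact hγ ⟨((b : ℚ) - b') / ((a : ℚ) - a'), by push_cast; exact hγeq.symm⟩

end Phase

section Density

/-- **THEOREM (Zariski density in the double-cancelling regime).**  `F₀F₁ ≠ 0`,
`deg F₁ < deg F₀`, `r₀r₁ < 0`, `r₁/r₀ ∉ ℚ`, any `c` ⟹ `I(W ∩ Γ_exp) = I(W)` for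
`W = {x₂ = r₀x₀ + r₁x₁ + c, y₀ = x₀ + y₂F₀(y₂), y₁ = x₁ + y₂F₁(y₂)}` — in particular on the
resonant mixed-sign line `e₀r₀ + e₁r₁ = 1`, `e₀ ≠ e₁`.  See the module docstring. (new)
[cite: MantovaMasser2023, §1 p.5 (the open case dim π(V) = 2 in ℂ³×ℂˣ³)] -/
theorem unprojectedDense_polyFibredGraph_doubleCancelling (F : Fin 2 → Polynomial ℂ)
    (hF0 : F 0 ≠ 0) (hF1 : F 1 ≠ 0) (hdeg : (F 1).natDegree < (F 0).natDegree)
    (r₀ r₁ : ℝ) (hsign : r₀ * r₁ < 0) (hirr : Irrational (r₁ / r₀)) (c : ℂ) :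
    UnprojectedDense (polyFibredGraph (hyperplanePoly ![r₀, r₁] c) (fun j => X j)
      (fun j => (F j).toMvPolynomial 0)) := by
  classical
  have hr₀ : r₀ ≠ 0 := by
    rintro rfl
    simp at hsign
  set e₀ : ℕ := (F 0).natDegree + 1 with he₀def
  set e₁ : ℕ := (F 1).natDegree + 1 with he₁def
  have he₁ : 1 ≤ e₁ := by omega
  have he : e₁ < e₀ := by omega
  have hdeg0 : (F 0).natDegree < e₀ := by omega
  have hdeg1 : (F 1).natDegree < e₁ := by omega
  set A : Fin 2 → ℕ → ℂ := fun j i => (F j).coeff i with hA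
  have ha₀ : A 0 (e₀ - 1) ≠ 0 := by
    simp only [hA, he₀def, Nat.add_sub_cancel, Polynomial.coeff_natDegree]
    exact Polynomial.leadingCoeff_ne_zero.2 hF0
  have ha₁ : A 1 (e₁ - 1) ≠ 0 := by
    simp only [hA, he₁def, Nat.add_sub_cancel, Polynomial.coeff_natDegree]
    exact Polynomial.leadingCoeff_ne_zero.2 hF1
  set r : Fin 2 → ℝ := ![r₀, r₁] with hrdef
  -- the phase and the solutions
  obtain ⟨s, hs, j₀, κ, hκ, hphase⟩ := exists_doubleCancelling_phase he₁ he ha₁ hr₀ ha₀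
  obtain ⟨x, hT, h0, hRe, hRe', hsol⟩ := exists_solutions_doubleCancelling e₀ e₁ he₁ he A ha₀ ha₁
    r₀ r₁ hr₀ hsign c hs j₀ hκ hphase
  set P3 : ℕ → Fin 3 ⊕ Fin 3 → ℂ := fun m =>
    pgParam (hyperplanePoly r c) (fun j => X j) (fun j => (F j).toMvPolynomial 0)
      (x m) (exp (∑ i, (r i : ℂ) * x m i + c)) with hP3
  -- the solution property in the shape of `pgParam_hyperplane_mem_expGraph`
  have hsolW : ∀ᶠ m in atTop, ∀ j : Fin 2, exp (x m j) = eval (x m) (X j) +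
      exp (∑ i, (r i : ℂ) * x m i + c) * (F j).eval (exp (∑ i, (r i : ℂ) * x m i + c)) := by
    filter_upwards [hsol] with m hm
    rw [Fin.forall_fin_two]
    refine ⟨?_, ?_⟩
    · rw [eval_X, Polynomial.eval_eq_sum_range' hdeg0]; exact hm.1
    · rw [eval_X, Polynomial.eval_eq_sum_range' hdeg1]; exact hm.2
  -- the three `y`-coordinates of the points
  have hc0 : ∀ᶠ m in atTop, P3 m (Sum.inr 0) = exp (x m 0) := by
    filter_upwards [hsolW] with m hm
    have e0 : (Sum.inr 0 : Fin 3 ⊕ Fin 3) = Sum.inr (Fin.castSucc (0 : Fin 2)) := rfl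
    simp only [hP3, e0, pgParam_inr, pMulParam_castSucc]
    rw [hm 0, MvPolynomial.eval_toMvPolynomial, Fin.cons_zero]
  have hc1 : ∀ᶠ m in atTop, P3 m (Sum.inr 1) = exp (x m 1) := by
    filter_upwards [hsolW] with m hm
    have e1 : (Sum.inr 1 : Fin 3 ⊕ Fin 3) = Sum.inr (Fin.castSucc (1 : Fin 2)) := rfl
    simp only [hP3, e1, pgParam_inr, pMulParam_castSucc]
    rw [hm 1, MvPolynomial.eval_toMvPolynomial, Fin.cons_zero]
  have hc2 : ∀ m, P3 m (Sum.inr 2) = exp (∑ i, (r i : ℂ) * x m i + c) := by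
    intro m
    have e2 : (Sum.inr 2 : Fin 3 ⊕ Fin 3) = Sum.inr (Fin.last 2) := rfl
    simp only [hP3, e2, pgParam_inr, pMulParam_last]
  refine unprojectedDense_of_twoScale (isIrreducibleClosed_polyFibredGraph _ _ _)
    (by rw [zariskiDim_polyFibredGraph]) ![Sum.inr 0, Sum.inr 1, Sum.inr 2] (p := P3) ?_
    (r₁ / r₀) (-1) (fun a b a' b' h => doubleCancellingWeights_injective hirr a b a' b' h) hT
    ?_ ?_ ?_ ?_
  · filter_upwards [hsolW] with m hm
    exact ⟨pgParam_mem _ _ _ _ _, pgParam_hyperplane_mem_expGraph r c (fun j => X j) F hm⟩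
  · -- `log|y₀| = Re x₀ ≈ (r₁/r₀)T`
    intro ε hε
    simp only [Matrix.cons_val_zero]
    filter_upwards [hc0, h0 ε hε] with m hm h
    rw [hm, Complex.norm_exp, Real.log_exp]
    exact ⟨Complex.exp_ne_zero _, h⟩
  · -- `log|y₁| = Re x₁ = −T`
    intro ε hε
    simp only [Matrix.cons_val_one, Matrix.cons_val_zero]
    filter_upwards [hc1, hT.eventually_ge_atTop 0] with m hm hTm
    rw [hm, Complex.norm_exp, Real.log_exp]
    refine ⟨Complex.exp_ne_zero _, ?_⟩
    rw [show (x m 1).re - -1 * -(x m 1).re = 0 by ring, abs_zero]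
    exact mul_nonneg hε.le hTm
  · -- `|y₂| → ∞`
    simp only [Matrix.cons_val_two, Matrix.tail_cons, Matrix.head_cons, hc2, Complex.norm_exp]
    exact Real.tendsto_exp_atTop.comp hRe
  · -- `log|y₂| = o(T)`
    intro ε hε
    simp only [Matrix.cons_val_two, Matrix.tail_cons, Matrix.head_cons]
    filter_upwards [hRe' ε hε] with m hm
    rw [hc2, Complex.norm_exp, Real.log_exp]
    exact hm

end Density

end Summit.Schanuel.Schanuel.Theorems
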